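import Summits.BirchSwinnertonDyer.BirchSwinnertonDyer.Theorems.GenusKolyvaginAtTwoTorsionCellSELIsoClassLawC1
import HarnessLib

/-!
# SEL corollary: Selmer-genericity of an iso-class genus pair ⟺ the Laplacian pair criterion (unconditional, decidable)

Crux R″ `RankOneTwoTorsionResidualAtTwo` (stmt-27478), LINE 49 «torsion_cell_full_vertex_bsdidea1» §8.  With stub SEL proved
(`isoClassSelmerPairLaw_unfolded`), the line's kernel corollary `isSelmerGenericPair_iff_criterion` becomes an unconditional tree theorem:
in a full base setting with `rank E₀(ℚ) = 0` and an iso-class `Q₀`, the genus pair `(C₀, C₁) = (T•E₀^{(M₀)}, T'•E₀^{(−p₀M₀)})` is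
SELMER-GENERIC (`#C(ℚ)[2] = 4, 4` and `#Sel₂ = 4, 8`) iff `det Φ₃(redeiLaplacian Q₀) = 1 ∧ det Φ₃(borderedLaplacian Q₀ p₀) = 1`
(`LaplacianPairCriterion Q₀ p₀`, decidable from the Legendre symbols of `Q₀ ∪ {p₀}`): **`selmerGenericPair_iff_laplacianPairCriterion`**
(the line's `IsSelmerGenericPair` / `FullBaseSetting` / `IsGenusPair` unfolded verbatim).

Everything is proved; no LINE 49 statement is restated; BSD is not advanced by this file alone.

## References

* [KlagsbrunMazurRubin2013] Z. Klagsbrun, B. Mazur, K. Rubin, Ann. of Math. 178 (2013), Thm. 3.9.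
* [Kane2013SelmerTwists] D. M. Kane, Algebra Number Theory 7 (2013), §2.
* [ShuZhai2021] J. Shu, S. Zhai, Trans. AMS 374 (2021), Def. 1.1, Thm. 1.2.
-/

noncomputable section

open scoped Classical

namespace Summit.BirchSwinnertonDyer.BirchSwinnertonDyer.Theorems.GenusKolyvaginAtTwo.TorsionCellSEL

open WeierstrassCurve WeierstrassCurve.Affine WeierstrassCurve.Affine.Point
open Literature.NumberTheory.GaloisRepresentations Literature.NumberTheory.EllipticCurves Field
open Literature.NumberTheory.EllipticCurves.ShuZhai2021 (qStar IsInertInSqrt AllPrimesSplitInSqrt IsOptimalDatum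
  CuspZeroNotInTwice)
open Literature.NumberTheory.EllipticCurves.ModularForms (ModularParametrizationData)
open Summit.BirchSwinnertonDyer.BirchSwinnertonDyer.Theorems.GenusKolyvaginAtTwo.FullVertex
open Matrix

/-- **SELMER-GENERIC ⟺ LAPLACIAN PAIR CRITERION** (see the module docstring). [cite: KlagsbrunMazurRubin2013, Thm. 3.9]
[cite: Kane2013SelmerTwists, §2] [cite: ShuZhai2021, Def. 1.1, Thm. 1.2] -/
theorem selmerGenericPair_iff_laplacianPairCriterion [inst : DecidableEq ℚ]
    (E₀ : WeierstrassCurve ℚ) [E₀.IsElliptic] [E₀.IsGloballyMinimal] [NeZero (E₀.conductorNorm ℤ)]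
    (Dt : ModularParametrizationData E₀ (E₀.conductorNorm ℤ)) (p₀ : ℕ) (Q₀ : Finset ℕ)
    (C₀ : WeierstrassCurve ℚ) [C₀.IsElliptic] (C₁ : WeierstrassCurve ℚ) [C₁.IsElliptic]
    (hB : (∃ P Q : E₀.toAffine.Point, P ≠ Q ∧ P ≠ 0 ∧ Q ≠ 0 ∧ 2 • P = 0 ∧ 2 • Q = 0) ∧
      (∀ x ∈ E₀.sha, (2 : ℕ) • x = 0 → x = 0) ∧ IsOptimalDatum E₀ Dt ∧ ¬ (2 : ℤ) ∣ Dt.c ∧ CuspZeroNotInTwice E₀ Dt ∧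
      p₀.Prime ∧ 3 < p₀ ∧ p₀ % 8 = 7 ∧ AllPrimesSplitInSqrt (2 * E₀.conductorNorm ℤ) (-(p₀ : ℤ)) ∧
      (∀ q ∈ Q₀, (q.Prime ∧ Nat.Coprime q (2 * E₀.conductorNorm ℤ) ∧
        ∀ (V' : WeierstrassCurve ℚ) [V'.IsElliptic], (∃ φ : Isogeny E₀ V', φ.degree = 2) → IsInertInSqrt q V'.Δ) ∧
          q ≠ p₀) ∧
      0 < (∏ q ∈ Q₀, qStar q) ∧ AllPrimesSplitInSqrt (2 * E₀.conductorNorm ℤ) (∏ q ∈ Q₀, qStar q))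
    (hmw₀ : E₀.mordellWeilRank = 0) (hiso : IsIsoClass (E₀.conductorNorm ℤ) Q₀)
    (hpair : (∃ T : VariableChange ℚ, T • E₀.quadraticTwist ((∏ q ∈ Q₀, qStar q : ℤ) : ℚ) = C₀) ∧
      (∃ T : VariableChange ℚ, T • E₀.quadraticTwist ((-(p₀ : ℤ) * ∏ q ∈ Q₀, qStar q : ℤ) : ℚ) = C₁)) :
    ((Nat.card (AddSubgroup.torsionBy C₀.toAffine.Point ((2 : ℕ) : ℤ)) = 4 ∧ Nat.card (C₀.selmerGroup ((2 : ℕ) : ℤ)) = 4) ∧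
      (Nat.card (AddSubgroup.torsionBy C₁.toAffine.Point ((2 : ℕ) : ℤ)) = 4 ∧ Nat.card (C₁.selmerGroup ((2 : ℕ) : ℤ)) = 8)) ↔
    LaplacianPairCriterion Q₀ p₀ := by
  obtain ⟨⟨ht₀, hs₀⟩, ⟨ht₁, hs₁⟩⟩ := isoClassSelmerPairLaw_unfolded (inst := inst) E₀ Dt p₀ Q₀ C₀ C₁ hB hmw₀ hiso hpair
  have hK₀ := one_le_card_ker_mulVecLin (phi3 (redeiLaplacian Q₀))
  have hK₁ := one_le_card_ker_mulVecLin (phi3 (borderedLaplacian Q₀ p₀))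
  rw [LaplacianPairCriterion, ← card_ker_mulVecLin_eq_one_iff_det_eq_one, ← card_ker_mulVecLin_eq_one_iff_det_eq_one]
  simp only [ht₀, ht₁, hs₀, hs₁, true_and]
  omega

end Summit.BirchSwinnertonDyer.BirchSwinnertonDyer.Theorems.GenusKolyvaginAtTwo.TorsionCellSEL

end
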